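import Summits.QuantumFields.YangMills.Theorems.BalabanUVNodesN15FullPropagatorC2BgUnitN15At

/-!
# Route «BalabanUVNodes», cluster K4 «SpineRates» — node N15 = NE2, file U-E (dag-n15-a g16, LOCATED-1): dag-n15-c's PRIMITIVE-CARRIER FAMILY WITH THE U-SEEING (2.156)
# UNIT LAYER (U-D `c2BgObjects`: operator AND unit layers read the background) AT BOTH STAGE-13 v1.7 `CoPH` HOMES AND AT THE READING OF RECORD — producer faces for
# n27-c's `h15`

Cell `pub-ymgap`, seat `pub-ymgap-dag-n15-a` (-a KNIT-BY-NAME seat of node N15; HUMAN RULING D-0062; chair R424 venue), generation 16, file U-E (THEOREMS ONLY, 0 `def`,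
0 `sorry`).  `bears_on: R4∕N15 · K3⁷ SpineGivenEndpointR13SepCoPH (stmt-QuantumFields-20544)`.  Filed `--kind proof --supports stmt-QuantumFields-20544 --as helper` — COUNT-NEUTRAL.
Imports U-D `…N15FullPropagatorC2BgUnitN15At` (`c2BgObjects`, `n15At_c2BgObjects_family`, `s_N15_of_admits_C2Bg_family`, `populated_c2BgObjects_family`; through part 81 the
`CoPH` home faces of part 75: `admits_rRec₁₃CoPH_ne2`, `s_N15_rRec₁₃CoPHOn_of_pin`, `s_N15_homes₁₃CoPH_of_forall_admissible`, `s_N15_readingOfRecord₁₃CoPH_homes_of_forall`,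
`readingOfRecord₁₃CoPH_populated_iff`); nothing in the tree is modified.

WHAT.  Part 81 §4 VERBATIM for `c2BgObjects` (every statement mentions the objects, so nothing restates a landed face): `s_N15_rRec₁₃CoPH_of_c2BgReading`,
`s_N15_rRec₁₃CoPHOn_of_c2BgReading`, ★★ `exists_reading_s_N15_rRec₁₃CoPH_c2Bg_family`, ★★ `s_N15_readingOfRecord₁₃CoPH_homes_of_c2Bg_family` (the shape n27-c's leaves consume,
conclusion both homes), `s_N15_readingOfRecord₁₃CoPH_of_c2Bg_family`, `s_N15_readingOfRecord₁₃CoPHOn_of_c2Bg_family`, `populated_readingOfRecord₁₃CoPH_of_c2Bg_family`.  Reading for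
the K3⁷ composer: the N15 slot is inhabited by a family whose OPERATOR and UNIT layers both READ the (model) background; the site layer is the genuine `U ≡ 1` scalar-sector kernel.

HONEST FRAMING.  Count-neutral kernel bookkeeping BY NAME; no estimate here (the estimates are U-A…U-D and their cited inputs).  MODEL-LEVEL: by-parts species, abelianised `Q`,
linearised symmetrised dressing of the (1.66) form; GENUINE: full `U ≡ 1` propagator, (1.66) matrix, (2.152)–(2.157) engine.  NOT [B9] Thms 3.1∕3.15 at a general (3.35)-regular
`U` (NOT PRINTED as η-rates), NOT Node 00's [B9] operator layer of record — **N15 is NOT discharged** (typed 28∕28 · discharged 5∕27 of record unchanged); the readings `𝔯`, towers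
`w1`, letters `ℓ₃`, NODE O's `ne1` are PARAMETERS; one finite four-torus programme at fixed `ε` — NOT ℝ⁴, NOT infinite volume, NOT OS, NOT a mass gap, NOT Clay.  Restate-immune.
-/

set_option autoImplicit false

noncomputable section

/-! ## The primitive-carrier family WITH THE U-SEEING UNIT LAYER at both Stage-13 v1.7 `CoPH` homes and at the reading of record (part 81's faces for THIS family) -/

namespace Summit.QuantumFields.YangMills.BalabanUVNodes.N15.AtReadingOfRecord13CoPH

open Literature.MathematicalPhysics.QuantumFieldTheory.Balaban1983to89
open Literature.MathematicalPhysics.QuantumFieldTheory.Balaban1983to89.T4Continuum (T4Family ULoop)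
open Node00 (IsDatumOfRecord₁₃CCoPH Stage13HParams NE2Objects₁₁ NE3Letters₁₁)
open Node00.W1 (ReadingData)
open Summit.QuantumFields.YangMills.BalabanUVNodes.N15.AtKeyedHome (neZero_blockFactor)
open Summit.QuantumFields.YangMills.BalabanUVNodes.N15.AtRRec13CoPH (admits_rRec₁₃CoPH_ne2 s_N15_rRec₁₃CoPHOn_of_pin s_N15_homes₁₃CoPH_of_forall_admissible)
open Summit.QuantumFields.YangMills.BalabanUVNodes.N15.UnitLayerBg (c2BgObjects n15At_c2BgObjects_family s_N15_of_admits_C2Bg_family populated_c2BgObjects_family)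
open YMDAG.UVSplit (Datum NE1pCarriers RateCarriers RateRecordPred N15At S_N15 ne2OfRecord₁₁ RateReading₁₃CoPH RRec₁₃CoPH RRec₁₃CoPHOn readingOfRecord₁₃CoPH
  readingOfRecord₁₃CoPH_populated_iff)

variable {N : ℕ} [NeZero N]

section C2Bg

variable {b aS : ℝ}

/-- ★ **THE PRIMITIVE-CARRIER READING CLOSES THE STUB AT THE CANONICAL HOME, NO ESTIMATE DISPLAYED.**  For `b, a_S > 0`, `c₃₅ > 0`, directions `α β`, exponent `p`: a
reading `𝔯` whose NE2 objects at every Stage-13 datum key ARE `c2BgObjects 3 F.hL b a_S α β c₃₅ p` (operator layer: Bałaban's full `U ≡ 1` propagator dressed by dag-n15-c's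
live first-order scalar background over the primitive (3.35)–(3.36) letters; site: `(Q′G′²Q′*)⁻¹`; unit: the (2.156) covariance; on the family's OWN block factor) has
`S_N15 (RRec₁₃CoPH 𝔯)` — §3 `s_N15_of_admits_C2Bg_family` at the certificate `admits_rRec₁₃CoPH_ne2`. [bookkeeping] -/
theorem s_N15_rRec₁₃CoPH_of_c2BgReading (hb : 0 < b) (haS : 0 < aS) {c35 : ℝ} (hc35 : 0 < c35) (α β : Fin 4) (p : ℝ) (𝔯 : RateReading₁₃CoPH N)
    (h : ∀ (F : T4Family) (D : Datum F N) (hD : IsDatumOfRecord₁₃CCoPH F N D) (g₀ : ℕ → ℝ) (os : List (ULoop F)) (k : ℕ),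
      (𝔯.lit F hD.params hD.provisos g₀ os).ne2 k = haveI := neZero_blockFactor F; c2BgObjects 3 F.hL b aS α β c35 p) :
    S_N15 (RRec₁₃CoPH 𝔯) :=
  s_N15_of_admits_C2Bg_family (N := N) (key := fun F D => IsDatumOfRecord₁₃CCoPH F N D) hb haS hc35 α β p
    (fun {F D} (hD : IsDatumOfRecord₁₃CCoPH F N D) g₀ os k => (𝔯.lit F hD.params hD.provisos g₀ os).ne2 k) (RRec₁₃CoPH 𝔯) (admits_rRec₁₃CoPH_ne2 𝔯) h

/-- ★ **THE PRIMITIVE-CARRIER READING CLOSES THE STUB AT EVERY GUARDED HOME** (θ-form on the admissible tuples with provisos in `Rg`; §3 at `(3, F.hL)` through 74b's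
`s_N15_rRec₁₃CoPHOn_of_pin`). [bookkeeping] -/
theorem s_N15_rRec₁₃CoPHOn_of_c2BgReading (hb : 0 < b) (haS : 0 < aS) {c35 : ℝ} (hc35 : 0 < c35) (α β : Fin 4) (p : ℝ) (𝔯 : RateReading₁₃CoPH N)
    (Rg : (F : T4Family) → Stage13HParams F N → Prop)
    (h : ∀ (F : T4Family) (θ : Stage13HParams F N) (hP : θ.Provisos₁₃CoPH F N), Rg F θ → θ.Admissible F N → ∀ (g₀ : ℕ → ℝ) (os : List (ULoop F)) (k : ℕ),
      (𝔯.lit F θ hP g₀ os).ne2 k = haveI := neZero_blockFactor F; c2BgObjects 3 F.hL b aS α β c35 p) :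
    S_N15 (RRec₁₃CoPHOn 𝔯 Rg) :=
  s_N15_rRec₁₃CoPHOn_of_pin 𝔯 Rg (fun F _ _ _ _ _ => haveI := neZero_blockFactor F; c2BgObjects 3 F.hL b aS α β c35 p) h
    fun F _ _ _ _ _ _ _ => n15At_c2BgObjects_family hb haS hc35 α β p F

/-- ★★ **SOME READING CLOSES THE STUB AT BOTH CoPH HOMES OUTRIGHT ON THE PRIMITIVE-CARRIER OBJECTS, POPULATED EVERYWHERE** [decided, non-degenerate, operator «+» live over
the primitive letters]: for `b, a_S > 0`, `c₃₅ > 0`, `α β`, `p` there is a Stage-13 rate reading `𝔯` whose NE2 objects at every tuple ARE `c2BgObjects 3 F.hL b a_S α β c₃₅ p`,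
`Populated` everywhere (RR-1 §8), with `S_N15 (RRec₁₃CoPH 𝔯)` and `S_N15 (RRec₁₃CoPHOn 𝔯 Rg)` for every `Rg`, NO hypothesis. [bookkeeping] -/
theorem exists_reading_s_N15_rRec₁₃CoPH_c2Bg_family (hb : 0 < b) (haS : 0 < aS) {c35 : ℝ} (hc35 : 0 < c35) (α β : Fin 4) (p : ℝ) :
    ∃ 𝔯 : RateReading₁₃CoPH N,
      (∀ (F : T4Family) (θ : Stage13HParams F N) (hP : θ.Provisos₁₃CoPH F N) (g₀ : ℕ → ℝ) (os : List (ULoop F)) (k : ℕ),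
        (𝔯.lit F θ hP g₀ os).ne2 k = haveI := neZero_blockFactor F; c2BgObjects 3 F.hL b aS α β c35 p) ∧
      (∀ (F : T4Family) (θ : Stage13HParams F N) (hP : θ.Provisos₁₃CoPH F N) (g₀ : ℕ → ℝ) (os : List (ULoop F)) (k : ℕ),
        ((𝔯.lit F θ hP g₀ os).ne2 k).Populated) ∧
      S_N15 (RRec₁₃CoPH 𝔯) ∧ ∀ Rg : (F : T4Family) → Stage13HParams F N → Prop, S_N15 (RRec₁₃CoPHOn 𝔯 Rg) := by
  obtain ⟨r₀⟩ := Node00.nonempty_rateObjects₁₁ (N := N)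
  let lit : (F : T4Family) → (θ : Stage13HParams F N) → θ.Provisos₁₃CoPH F N → (ℕ → ℝ) → List (ULoop F) → Node00.RateObjects₁₁ N :=
    fun F _ _ _ _ => ⟨r₀.u3, r₀.ne3, fun _ => haveI := neZero_blockFactor F; c2BgObjects 3 F.hL b aS α β c35 p⟩
  let 𝔯 : RateReading₁₃CoPH N := ⟨lit, fun _ _ _ _ _ => (⟨Empty, ⟨fun q => q.elim, fun q => q.elim, fun q => q.elim⟩, 0⟩ : NE1pCarriers)⟩
  have h𝔯 : ∀ (F : T4Family) (θ : Stage13HParams F N) (hP : θ.Provisos₁₃CoPH F N) (g₀ : ℕ → ℝ) (os : List (ULoop F)) (k : ℕ),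
      (𝔯.lit F θ hP g₀ os).ne2 k = haveI := neZero_blockFactor F; c2BgObjects 3 F.hL b aS α β c35 p := fun _ _ _ _ _ _ => rfl
  have hS := s_N15_homes₁₃CoPH_of_forall_admissible 𝔯 fun F θ hP _ g₀ os k => by
    rw [h𝔯 F θ hP g₀ os k]
    exact n15At_c2BgObjects_family hb haS hc35 α β p F
  refine ⟨𝔯, h𝔯, fun F θ hP g₀ os k => ?_, hS.1, hS.2⟩
  rw [h𝔯 F θ hP g₀ os k]
  exact populated_c2BgObjects_family F b aS α β c35 p

variable (w1 : (F : T4Family) → (θ : Stage13HParams F N) → ReadingData F (Node00.MatA N) θ.τ9.M) (ℓ₃ : T4Family → NE3Letters₁₁)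
  (ne2 : (F : T4Family) → Stage13HParams F N → (ℕ → ℝ) → List (ULoop F) → ℕ → NE2Objects₁₁)
  (ne1 : (F : T4Family) → Stage13HParams F N → (ℕ → ℝ) → List (ULoop F) → NE1pCarriers)

/-- ★★ **THE PRIMITIVE-CARRIER RESIDUAL LAYER CLOSES `h15` AT BOTH HOMES OF THE READING OF RECORD, NO ESTIMATE DISPLAYED** — the shape dag-n27-c's
`spine_rec13CCoPH_at_readingAdm₁₃CoPH_of_…_family` leaves consume: if on the admissible Stage-13 tuples with provisos N15's residual layer `ne2` takes the primitive-carrier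
objects `c2BgObjects 3 F.hL b a_S α β c₃₅ p` as values, then `S_N15` at `RRec₁₃CoPH (readingOfRecord₁₃CoPH w1 ℓ₃ ne2 ne1)` AND at every `RRec₁₃CoPHOn (…) Rg` — the operator
layer with the background block LIVE over the primitive (3.35)–(3.36) letters (dag-n15-c FILE 11) and the two `U ≡ 1` kernel layers are theorems (§1), not hypotheses; plain
`b, a_S, c₃₅ > 0`. [bookkeeping] -/
theorem s_N15_readingOfRecord₁₃CoPH_homes_of_c2Bg_family (hb : 0 < b) (haS : 0 < aS) {c35 : ℝ} (hc35 : 0 < c35) (α β : Fin 4) (p : ℝ)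
    (h : ∀ (F : T4Family) (θ : Stage13HParams F N), θ.Provisos₁₃CoPH F N → θ.Admissible F N → ∀ (g₀ : ℕ → ℝ) (os : List (ULoop F)) (k : ℕ),
      ne2 F θ g₀ os k = haveI := neZero_blockFactor F; c2BgObjects 3 F.hL b aS α β c35 p) :
    S_N15 (RRec₁₃CoPH (readingOfRecord₁₃CoPH w1 ℓ₃ ne2 ne1)) ∧
      ∀ Rg : (F : T4Family) → Stage13HParams F N → Prop, S_N15 (RRec₁₃CoPHOn (readingOfRecord₁₃CoPH w1 ℓ₃ ne2 ne1) Rg) :=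
  s_N15_readingOfRecord₁₃CoPH_homes_of_forall w1 ℓ₃ ne2 ne1 fun F θ hP hA g₀ os k => by
    rw [h F θ hP hA g₀ os k]
    exact n15At_c2BgObjects_family hb haS hc35 α β p F

/-- … at the canonical home alone. [bookkeeping] -/
theorem s_N15_readingOfRecord₁₃CoPH_of_c2Bg_family (hb : 0 < b) (haS : 0 < aS) {c35 : ℝ} (hc35 : 0 < c35) (α β : Fin 4) (p : ℝ)
    (h : ∀ (F : T4Family) (θ : Stage13HParams F N), θ.Provisos₁₃CoPH F N → θ.Admissible F N → ∀ (g₀ : ℕ → ℝ) (os : List (ULoop F)) (k : ℕ),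
      ne2 F θ g₀ os k = haveI := neZero_blockFactor F; c2BgObjects 3 F.hL b aS α β c35 p) :
    S_N15 (RRec₁₃CoPH (readingOfRecord₁₃CoPH w1 ℓ₃ ne2 ne1)) :=
  (s_N15_readingOfRecord₁₃CoPH_homes_of_c2Bg_family w1 ℓ₃ ne2 ne1 hb haS hc35 α β p h).1

/-- … at the `Rg`-guarded home (every `Rg`). [bookkeeping] -/
theorem s_N15_readingOfRecord₁₃CoPHOn_of_c2Bg_family (hb : 0 < b) (haS : 0 < aS) {c35 : ℝ} (hc35 : 0 < c35) (α β : Fin 4) (p : ℝ)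
    (h : ∀ (F : T4Family) (θ : Stage13HParams F N), θ.Provisos₁₃CoPH F N → θ.Admissible F N → ∀ (g₀ : ℕ → ℝ) (os : List (ULoop F)) (k : ℕ),
      ne2 F θ g₀ os k = haveI := neZero_blockFactor F; c2BgObjects 3 F.hL b aS α β c35 p)
    (Rg : (F : T4Family) → Stage13HParams F N → Prop) : S_N15 (RRec₁₃CoPHOn (readingOfRecord₁₃CoPH w1 ℓ₃ ne2 ne1) Rg) :=
  (s_N15_readingOfRecord₁₃CoPH_homes_of_c2Bg_family w1 ℓ₃ ne2 ne1 hb haS hc35 α β p h).2 Rg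

/-- … such a reading of record is `Populated` at every Stage-13 tuple with provisos (§3 `populated_c2BgObjects_family`). [bookkeeping] -/
theorem populated_readingOfRecord₁₃CoPH_of_c2Bg_family (α β : Fin 4) (c35 p : ℝ) (F : T4Family) (θ : Stage13HParams F N)
    (hP : θ.Provisos₁₃CoPH F N) (g₀ : ℕ → ℝ) (os : List (ULoop F))
    (h : ∀ k : ℕ, ne2 F θ g₀ os k = haveI := neZero_blockFactor F; c2BgObjects 3 F.hL b aS α β c35 p) :
    ((readingOfRecord₁₃CoPH w1 ℓ₃ ne2 ne1).lit F θ hP g₀ os).Populated := by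
  refine (readingOfRecord₁₃CoPH_populated_iff w1 ℓ₃ ne2 ne1 F θ hP g₀ os).2 fun k => ?_
  rw [h k]
  exact populated_c2BgObjects_family F b aS α β c35 p

/-! NOTE.  The pure-existence face «SOME residual layer closes `h15` at both homes, populated everywhere» (part 80's `exists_ne2_s_N15_readingOfRecord₁₃CoPH_byParts`)
has a statement that does not mention the witnessing family; the primitive-carrier family is ANOTHER witness of that SAME landed statement (by the theorems above) — it is
cited, not re-filed (gate `dedup.landed`). -/

end C2Bg

end Summit.QuantumFields.YangMills.BalabanUVNodes.N15.AtReadingOfRecord13CoPH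

end
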